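import Summits.CriticalPhenomena.PercolationContinuityZ3.Theses.PercNonProliferation
import Summits.CriticalPhenomena.PercolationContinuityZ3.Theses.PercBudgetLadder
import Summits.CriticalPhenomena.PercolationContinuityZ3.Theorems.PercNonProliferationNonProliferationRatioDichotomy
import Summits.CriticalPhenomena.PercolationContinuityZ3.Theorems.PercNonProliferationAssembly
import Summits.CriticalPhenomena.PercolationContinuityZ3.Theorems.PercNonProliferationSpanningPiecesCount
import Summits.CriticalPhenomena.PercolationContinuityZ3.Theorems.PercNonProliferationDensityWhp
import Summits.CriticalPhenomena.PercolationContinuityZ3.Theorems.PercShatteringRaceRaceLemma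
import Literature.Probability.Percolation.HalfSpacePinnedPairs
import Literature.Probability.Percolation.PercolationProofs
import Literature.Probability.Percolation.ConnectivityProofs
import HarnessLib

/-!
# Line `jump-fragmentation` — crux `PercNonProliferation.NonProliferation` (stmt-CriticalPhenomena-4444)

Crux-strategist skeleton (wall-breaker, gen 1). The crux is re-cut along INFINITE / FINITE / CONTINUOUS
instead of along a covering, a ledger or a blocking lever:

* `stub_infiniteClusterFewClasses` (**S1, the load-bearing stub**): at `p_c(ℤ³)`, for some `M`, `c > 0`
  and infinitely many `n`, with probability `≥ c` there are no `M+1` PERCOLATING points of `B(n)` pairwise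
  unjoined inside `B(2n)` — the infinite open cluster, if there is one at `p_c`, meets `B(n)` in at most
  `M` classes of the relation "joined inside the free box `B(2n)`". Trivially true if `θ(p_c) = 0`
  (`infiniteClusterFewClasses_of_continuity`), weaker than the crux (`infiniteClusterFewClasses_of_nonProliferation`),
  and — this is the point of the line — it ALONE carries what route `PercNonProliferation` needs from the crux:
  `continuity_of_freeBoxSparse_of_fewClasses : FreeBoxSparse → S1 → θ(p_c(ℤ³)) = 0` is proved below over
  the three landed supports. It holds verbatim wherever `θ(p_c) = 0` is a theorem, so the barrier
  `SpanningClustersAboveSix` (`Negative.nonProliferation_false_without_dimThree`) does NOT bite it; its wall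
  is sprinkling-free finite-volume uniqueness of a hypothetical critical infinite cluster
  (barrier `SprinklingRenormalisation`; BGN's half-space steering the one evasion in print).
* `stub_jumpFiniteDebrisTight` (**S2**): if `θ(p_c) > 0`, the number of FINITE-cluster spanning pieces of the
  annulus is tight (`∀ ε ∃ M ∀ᶠ n, P(M+1 non-percolating spanning representatives, pairwise unjoined) ≤ ε`).
  A Kesten–Zhang-type statement in the jump world; implied by `PercDebrisSweep.FiniteClusterVolumeTail`
  (stmt-CriticalPhenomena-0943) with `M = 0` (finite spanning pieces have volume `> n`; bridge to be landed
  by the lead).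
* `stub_contSureResidue` (**S3, park**): if `θ(p_c) = 0` and the critical annulus is crossed with probability
  → 1 at EVERY ratio `k ≥ 2`, the crux still holds. This is the crux's entire hyperscaling content (false
  for `d ≥ 7` under (t-c), where both hypotheses hold) and it is VACUOUSLY implied by the target
  `PercBudgetLadder.CritAnnulusBlockedIO` (stmt-CriticalPhenomena-5247): `contSureResidue_of_critAnnulusBlockedIO`.
  Do not staff it: every earlier line of this crux (ζ₃ > 2, a_cell > 2, birth budget) attacked exactly this stub.

Composition `NonProliferation_of : S1 → S2 → S3 → NonProliferation` (kernel-checked): cases on `θ(p_c) = 0`;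
continuous case — if the crux failed, the landed ratio dichotomy `crossing_tendsto_one_of_not_nonProliferation`
gives sure crossing at every ratio and S3 returns the crux; jump case — at a frequent scale of S1 where S2's
debris event has probability `≤ c/2`, pigeonhole: `M₁+M₂+1` pairwise-unjoined spanning representatives contain
`M₁+1` percolating or `M₂+1` non-percolating ones.

## STATUS (lead c8, 2026-08-17) — everything provable on this line is in `Theorems/` (`--supports` the crux)

* composition socket (= `NonProliferation_of` with the stubs spelled out): `…JumpFragmentation.lean` (p145944);
* split glue + certificates of the JUMP/CONTINUOUS decomposition: `…JumpContinuousSplit.lean` (p145173);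
* S ⟹ S1, crux ⟹ S1, **FreeBoxSparse ∧ S1 ⟹ S** (`continuity_of_freeBoxSparse_of_fewClasses`): `…FewClasses.lean` (p145974);
  at any fixed ratio `k ≥ 1`: `…FewClassesRatio.lean` (p148984);
* S2 ⟸ stmt-0943 (`jumpFiniteDebrisTight_of_finiteClusterVolumeTail`, `M = 0`): `…StubJumpFiniteDebrisTight.lean` (p147786);
* S3 ⟸ stmt-5247 (`contSureResidue_of_critAnnulusBlockedIO`, vacuous): `…StubContSureResidue.lean` (p147999);
* S1 calibrated: true at `d = 2` and for every `d ≥ 7` under (t-c) where the `d`-dimensional crux fails (`…FewClassesCalibration.lean`,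
  p148278); free when the outer box is decoupled from the inner one (`…FewClassesRatioFree.lean`, p148679); tool: the would-be critical
  infinite cluster is one-ended (`…CriticalClusterOneEnd.lean`, p148508); TRUE AT EVERY `p ≠ p_c(ℤ³)` — supercritical local
  uniqueness via Grimmett's Lemma 7.89 / Grimmett–Marstrand, subcritical trivially (`…FewClassesSupercritical.lean`, p149608).

* (lead c9, 2026-08-17) S1's POLYNOMIAL-RATIO shadow (`…FewClassesPoly.lean`, p152429; registered lead-extra stubs
  `fewClassesPoly_above_48` / `fewClassesPoly_of_critBoxTwoArmsDecay` / `fewClassesPoly_frequently_above_48`): with the outer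
  box `B(⌈n^α⌉)` in place of `B(2n)` and `M = 1`, S1's event has probability `→ 1` for every `α > 48` UNCONDITIONALLY (bond
  Cerf 2015 Thm 1.2 at `p_c`, `NearLinearTwoClusterDecay.CritFrontier.critBoxTwoArmsDecay_above_48`) and for every `α > 1`
  granted the sibling crux stmt-CriticalPhenomena-0859 `PercFiniteBoxLRO.CritBoxTwoArmsDecay`; S1 is the LINEAR-ratio
  endpoint (`α → 1`) of that family restricted to percolating points, covered by no existing item
  (barriers `SameDensityLocalUniqueness` / `SprinklingRenormalisation`).

Open: S1 (held; honestly summit-strength modulo FreeBoxSparse — handed back `promote-stub` by c8, confirmed by c9),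
S2 (⟸ 0943), S3 (⟸ 5247, parked). The three `sorry`s below are exactly these registered stubs; nothing else in this file is open.
-/

noncomputable section

namespace Summit.CriticalPhenomena.PercolationContinuityZ3.Cruxes.NonProliferation.JumpFragmentation

open MeasureTheory Filter Topology
open Literature.Probability.LatticeModels Literature.Probability.Percolation
open Summit.CriticalPhenomena.PercolationContinuityZ3.Theses.PercNonProliferation
open Summit.CriticalPhenomena.PercolationContinuityZ3.Theorems
open Summit.CriticalPhenomena.PercolationContinuityZ3.Theorems.NonProliferation

/-! ### Registered stubs (statements) -/

namespace Stubs

/-- **S1 (load-bearing): the critical infinite cluster does not fragment across annuli.** At `p_c(ℤ³)` there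
are `M` and `c > 0` such that for infinitely many `n`, with probability `≥ c`, there are no `M+1` percolating
points of `B(n)` pairwise NOT joined by an open path inside `B(2n)`. Vacuously true if `θ(p_c) = 0`; implied by
the crux; with `FreeBoxSparse` it decides the summit (`continuity_of_freeBoxSparse_of_fewClasses`). OPEN
(sprinkling-free finite-volume uniqueness at `p_c`; barrier `SprinklingRenormalisation`, NOT `SpanningClustersAboveSix`). -/
def stub_infiniteClusterFewClasses : Prop :=
  ∃ (M : ℕ) (c : ℝ), 0 < c ∧ ∃ᶠ n : ℕ in atTop, c ≤ (bondPercolation (zdGraph 3) (criticalProbI 3)).real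
      {ω | ¬ ∃ x : Fin (M + 1) → Site 3, (∀ i, x i ∈ box 3 n) ∧ (∀ i, ω ∈ percolatesAt (x i)) ∧
        ∀ i j, i ≠ j → ω ∉ openConnIn (↑(box 3 (2 * n)) : Set (Site 3)) (x i) (x j)}

/-- **S2: in a jump world the finite spanning debris is tight.** If `θ(p_c(ℤ³)) > 0` then for every `ε > 0` there
is `M` such that for all large `n`, with probability `≤ ε` there are `M+1` NON-percolating points of `B(n)`, each
joined inside `B(2n)` to `∂ⁱⁿB(2n)`, pairwise not joined inside `B(2n)`. Kesten–Zhang type; implied with `M = 0` by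
`PercDebrisSweep.FiniteClusterVolumeTail` (stmt-CriticalPhenomena-0943). OPEN (jump-world). -/
def stub_jumpFiniteDebrisTight : Prop :=
  0 < theta (zdGraph 3) (0 : Site 3) (criticalProbI 3) →
    ∀ ε : ℝ, 0 < ε → ∃ M : ℕ, ∀ᶠ n : ℕ in atTop, (bondPercolation (zdGraph 3) (criticalProbI 3)).real
      {ω | ∃ x : Fin (M + 1) → Site 3, (∀ i, x i ∈ box 3 n) ∧ (∀ i, ω ∉ percolatesAt (x i)) ∧
        (∀ i, ∃ y ∈ innerBoundary (zdGraph 3) (box 3 (2 * n)),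
          ω ∈ openConnIn (↑(box 3 (2 * n)) : Set (Site 3)) (x i) y) ∧
        ∀ i j, i ≠ j → ω ∉ openConnIn (↑(box 3 (2 * n)) : Set (Site 3)) (x i) (x j)} ≤ ε

/-- **S3 (residue — PARK behind stmt-CriticalPhenomena-5247): the crux in a continuous world with sure crossing.**
If `θ(p_c(ℤ³)) = 0` and at every fixed ratio `k ≥ 2` the critical annulus `B(m) → ∂ⁱⁿB(km)` is crossed inside
`B(km)` with probability tending to one, then (the crux's statement, spelled out). The crux's ENTIRE hyperscaling
content (false for `d ≥ 7` under (t-c), where both hypotheses hold): every earlier line's open stub implies it; it is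
VACUOUSLY implied by `PercBudgetLadder.CritAnnulusBlockedIO` (`contSureResidue_of_critAnnulusBlockedIO`). -/
def stub_contSureResidue : Prop :=
  theta (zdGraph 3) (0 : Site 3) (criticalProbI 3) = 0 →
    (∀ k : ℕ, 2 ≤ k → Tendsto (fun m : ℕ => (bondPercolation (zdGraph 3) (criticalProbI 3)).real
      {ω | ∃ x ∈ box 3 m, ∃ y ∈ innerBoundary (zdGraph 3) (box 3 (k * m)),
        ω ∈ openConnIn (↑(box 3 (k * m)) : Set (Site 3)) x y}) atTop (𝓝 1)) →
    ∃ (M : ℕ) (c : ℝ), 0 < c ∧ ∃ᶠ n : ℕ in atTop, c ≤ (bondPercolation (zdGraph 3) (criticalProbI 3)).real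
      {ω | ¬ ∃ x : Fin (M + 1) → Site 3, (∀ i, x i ∈ box 3 n) ∧
        (∀ i, ∃ y ∈ innerBoundary (zdGraph 3) (box 3 (2 * n)),
          ω ∈ openConnIn (↑(box 3 (2 * n)) : Set (Site 3)) (x i) y) ∧
        ∀ i j, i ≠ j → ω ∉ openConnIn (↑(box 3 (2 * n)) : Set (Site 3)) (x i) (x j)}

end Stubs

/-! ### The stubs, spelled out (registered by name + signature) -/

/-- Registered stub `stub_infiniteClusterFewClasses` (S1) — OPEN, load-bearing. -/
theorem stub_infiniteClusterFewClasses :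
    ∃ (M : ℕ) (c : ℝ), 0 < c ∧ ∃ᶠ n : ℕ in atTop, c ≤ (bondPercolation (zdGraph 3) (criticalProbI 3)).real
      {ω | ¬ ∃ x : Fin (M + 1) → Site 3, (∀ i, x i ∈ box 3 n) ∧ (∀ i, ω ∈ percolatesAt (x i)) ∧
        ∀ i j, i ≠ j → ω ∉ openConnIn (↑(box 3 (2 * n)) : Set (Site 3)) (x i) (x j)} := by
  sorry

/-- Registered stub `stub_jumpFiniteDebrisTight` (S2) — OPEN (⟸ stmt-CriticalPhenomena-0943 with `M = 0`). -/
theorem stub_jumpFiniteDebrisTight :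
    0 < theta (zdGraph 3) (0 : Site 3) (criticalProbI 3) →
    ∀ ε : ℝ, 0 < ε → ∃ M : ℕ, ∀ᶠ n : ℕ in atTop, (bondPercolation (zdGraph 3) (criticalProbI 3)).real
      {ω | ∃ x : Fin (M + 1) → Site 3, (∀ i, x i ∈ box 3 n) ∧ (∀ i, ω ∉ percolatesAt (x i)) ∧
        (∀ i, ∃ y ∈ innerBoundary (zdGraph 3) (box 3 (2 * n)),
          ω ∈ openConnIn (↑(box 3 (2 * n)) : Set (Site 3)) (x i) y) ∧
        ∀ i j, i ≠ j → ω ∉ openConnIn (↑(box 3 (2 * n)) : Set (Site 3)) (x i) (x j)} ≤ ε := by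
  sorry

/-- Registered stub `stub_contSureResidue` (S3) — PARK (⟸ stmt-CriticalPhenomena-5247, vacuously). -/
theorem stub_contSureResidue :
    theta (zdGraph 3) (0 : Site 3) (criticalProbI 3) = 0 →
    (∀ k : ℕ, 2 ≤ k → Tendsto (fun m : ℕ => (bondPercolation (zdGraph 3) (criticalProbI 3)).real
      {ω | ∃ x ∈ box 3 m, ∃ y ∈ innerBoundary (zdGraph 3) (box 3 (k * m)),
        ω ∈ openConnIn (↑(box 3 (k * m)) : Set (Site 3)) x y}) atTop (𝓝 1)) →
    ∃ (M : ℕ) (c : ℝ), 0 < c ∧ ∃ᶠ n : ℕ in atTop, c ≤ (bondPercolation (zdGraph 3) (criticalProbI 3)).real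
      {ω | ¬ ∃ x : Fin (M + 1) → Site 3, (∀ i, x i ∈ box 3 n) ∧
        (∀ i, ∃ y ∈ innerBoundary (zdGraph 3) (box 3 (2 * n)),
          ω ∈ openConnIn (↑(box 3 (2 * n)) : Set (Site 3)) (x i) y) ∧
        ∀ i j, i ≠ j → ω ∉ openConnIn (↑(box 3 (2 * n)) : Set (Site 3)) (x i) (x j)} := by
  sorry

theorem stub_infiniteClusterFewClasses_iff : Stubs.stub_infiniteClusterFewClasses ↔
    ∃ (M : ℕ) (c : ℝ), 0 < c ∧ ∃ᶠ n : ℕ in atTop, c ≤ (bondPercolation (zdGraph 3) (criticalProbI 3)).real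
      {ω | ¬ ∃ x : Fin (M + 1) → Site 3, (∀ i, x i ∈ box 3 n) ∧ (∀ i, ω ∈ percolatesAt (x i)) ∧
        ∀ i j, i ≠ j → ω ∉ openConnIn (↑(box 3 (2 * n)) : Set (Site 3)) (x i) (x j)} := Iff.rfl

theorem stub_jumpFiniteDebrisTight_iff : Stubs.stub_jumpFiniteDebrisTight ↔
    (0 < theta (zdGraph 3) (0 : Site 3) (criticalProbI 3) →
    ∀ ε : ℝ, 0 < ε → ∃ M : ℕ, ∀ᶠ n : ℕ in atTop, (bondPercolation (zdGraph 3) (criticalProbI 3)).real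
      {ω | ∃ x : Fin (M + 1) → Site 3, (∀ i, x i ∈ box 3 n) ∧ (∀ i, ω ∉ percolatesAt (x i)) ∧
        (∀ i, ∃ y ∈ innerBoundary (zdGraph 3) (box 3 (2 * n)),
          ω ∈ openConnIn (↑(box 3 (2 * n)) : Set (Site 3)) (x i) y) ∧
        ∀ i j, i ≠ j → ω ∉ openConnIn (↑(box 3 (2 * n)) : Set (Site 3)) (x i) (x j)} ≤ ε) := Iff.rfl

theorem stub_contSureResidue_iff : Stubs.stub_contSureResidue ↔
    (theta (zdGraph 3) (0 : Site 3) (criticalProbI 3) = 0 →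
    (∀ k : ℕ, 2 ≤ k → Tendsto (fun m : ℕ => (bondPercolation (zdGraph 3) (criticalProbI 3)).real
      {ω | ∃ x ∈ box 3 m, ∃ y ∈ innerBoundary (zdGraph 3) (box 3 (k * m)),
        ω ∈ openConnIn (↑(box 3 (k * m)) : Set (Site 3)) x y}) atTop (𝓝 1)) →
    ∃ (M : ℕ) (c : ℝ), 0 < c ∧ ∃ᶠ n : ℕ in atTop, c ≤ (bondPercolation (zdGraph 3) (criticalProbI 3)).real
      {ω | ¬ ∃ x : Fin (M + 1) → Site 3, (∀ i, x i ∈ box 3 n) ∧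
        (∀ i, ∃ y ∈ innerBoundary (zdGraph 3) (box 3 (2 * n)),
          ω ∈ openConnIn (↑(box 3 (2 * n)) : Set (Site 3)) (x i) y) ∧
        ∀ i j, i ≠ j → ω ∉ openConnIn (↑(box 3 (2 * n)) : Set (Site 3)) (x i) (x j)}) := Iff.rfl

/-! ### Pigeonhole: splitting a tuple of representatives by a predicate -/

/-- From a finite set `t` of indices of cardinality `K + 1`, all satisfying `P`, extract a `Fin (K+1)`-tuple of
pairwise distinct indices satisfying `P`. -/
theorem exists_tuple_of_card {N K : ℕ} (t : Finset (Fin N)) (ht : t.card = K + 1) (P : Fin N → Prop)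
    (hP : ∀ i ∈ t, P i) :
    ∃ f : Fin (K + 1) → Fin N, Function.Injective f ∧ ∀ a, P (f a) := by
  classical
  let e : Fin (K + 1) → t := fun a => t.equivFin.symm (Fin.cast ht.symm a)
  refine ⟨fun a => (e a).1, ?_, fun a => hP _ (e a).2⟩
  intro a b hab
  have h1 : e a = e b := Subtype.ext hab
  have h2 : Fin.cast ht.symm a = Fin.cast ht.symm b := t.equivFin.symm.injective h1
  exact Fin.cast_injective _ h2

/-- **Pigeonhole.** Given `M₁ + M₂ + 1` representatives `x i`, pairwise `bad`-related for distinct indices,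
either `M₁ + 1` of them satisfy `Q` or `M₂ + 1` of them satisfy `¬ Q` (as sub-tuples, still pairwise `bad`). -/
theorem pigeonhole_tuple {α : Type*} {M₁ M₂ : ℕ} (x : Fin (M₁ + M₂ + 1) → α) (Q : α → Prop)
    (bad : α → α → Prop) (hbad : ∀ i j, i ≠ j → bad (x i) (x j)) :
    (∃ y : Fin (M₁ + 1) → α, (∀ a, ∃ i, y a = x i) ∧ (∀ a, Q (y a)) ∧ ∀ a b, a ≠ b → bad (y a) (y b)) ∨
    (∃ y : Fin (M₂ + 1) → α, (∀ a, ∃ i, y a = x i) ∧ (∀ a, ¬ Q (y a)) ∧ ∀ a b, a ≠ b → bad (y a) (y b)) := by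
  classical
  set s : Finset (Fin (M₁ + M₂ + 1)) := Finset.univ.filter fun i => Q (x i) with hs
  set s' : Finset (Fin (M₁ + M₂ + 1)) := Finset.univ.filter fun i => ¬ Q (x i) with hs'
  have hcard : s.card + s'.card = M₁ + M₂ + 1 := by
    have h := Finset.card_filter_add_card_filter_not (s := (Finset.univ : Finset (Fin (M₁ + M₂ + 1))))
      (fun i => Q (x i))
    simpa [hs, hs'] using h
  by_cases h1 : M₁ + 1 ≤ s.card
  · left
    obtain ⟨t, hts, htc⟩ := Finset.exists_subset_card_eq h1
    obtain ⟨f, hf, hfP⟩ := exists_tuple_of_card t htc (fun i => Q (x i))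
      (fun i hi => (Finset.mem_filter.1 (hts hi)).2)
    exact ⟨fun a => x (f a), fun a => ⟨f a, rfl⟩, hfP, fun a b hab => hbad _ _ (fun h => hab (hf h))⟩
  · right
    have h2 : M₂ + 1 ≤ s'.card := by omega
    obtain ⟨t, hts, htc⟩ := Finset.exists_subset_card_eq h2
    obtain ⟨f, hf, hfP⟩ := exists_tuple_of_card t htc (fun i => ¬ Q (x i))
      (fun i hi => (Finset.mem_filter.1 (hts hi)).2)
    exact ⟨fun a => x (f a), fun a => ⟨f a, rfl⟩, hfP, fun a b hab => hbad _ _ (fun h => hab (hf h))⟩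

/-! ### Composition -/

/-- `θ(p_c(ℤ³)) ≥ 0`. [folklore] -/
theorem theta_nonneg : 0 ≤ theta (zdGraph 3) (0 : Site 3) (criticalProbI 3) := by
  unfold theta
  exact measureReal_nonneg

/-- **COMPOSITION: S1 → S2 → S3 → the crux**, by name (the registered skeleton theorem). -/
theorem NonProliferation_of (hS1 : Stubs.stub_infiniteClusterFewClasses) (hS2 : Stubs.stub_jumpFiniteDebrisTight)
    (hS3 : Stubs.stub_contSureResidue) :
    Summit.CriticalPhenomena.PercolationContinuityZ3.Theses.PercNonProliferation.NonProliferation := by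
  rw [stub_infiniteClusterFewClasses_iff] at hS1
  rw [stub_jumpFiniteDebrisTight_iff] at hS2
  rw [stub_contSureResidue_iff] at hS3
  by_cases h0 : theta (zdGraph 3) (0 : Site 3) (criticalProbI 3) = 0
  · -- continuous world: either the crux holds, or sure crossing at every ratio and S3 gives it
    by_contra hNP
    exact hNP (hS3 h0 (fun k hk => crossing_tendsto_one_of_not_nonProliferation hNP hk))
  · -- jump world: S1 at a frequent scale, S2 w.h.p., pigeonhole
    have hpos : 0 < theta (zdGraph 3) (0 : Site 3) (criticalProbI 3) :=
      lt_of_le_of_ne theta_nonneg (Ne.symm h0)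
    obtain ⟨M₁, c, hc, hfreq⟩ := hS1
    obtain ⟨M₂, hev⟩ := hS2 hpos (c / 2) (by linarith)
    set μ : Measure (BondConfig (Site 3)) := bondPercolation (zdGraph 3) (criticalProbI 3) with hμ
    unfold Summit.CriticalPhenomena.PercolationContinuityZ3.Theses.PercNonProliferation.NonProliferation
    refine ⟨M₁ + M₂, c / 2, by linarith, ?_⟩
    refine (hfreq.and_eventually hev).mono ?_
    rintro n ⟨hA, hD⟩
    -- names for the three events at scale `n`
    set A : Set (BondConfig (Site 3)) := {ω | ¬ ∃ x : Fin (M₁ + 1) → Site 3, (∀ i, x i ∈ box 3 n) ∧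
        (∀ i, ω ∈ percolatesAt (x i)) ∧
        ∀ i j, i ≠ j → ω ∉ openConnIn (↑(box 3 (2 * n)) : Set (Site 3)) (x i) (x j)} with hAdef
    set D : Set (BondConfig (Site 3)) := {ω | ∃ x : Fin (M₂ + 1) → Site 3, (∀ i, x i ∈ box 3 n) ∧
        (∀ i, ω ∉ percolatesAt (x i)) ∧
        (∀ i, ∃ y ∈ innerBoundary (zdGraph 3) (box 3 (2 * n)),
          ω ∈ openConnIn (↑(box 3 (2 * n)) : Set (Site 3)) (x i) y) ∧
        ∀ i j, i ≠ j → ω ∉ openConnIn (↑(box 3 (2 * n)) : Set (Site 3)) (x i) (x j)} with hDdef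
    set G : Set (BondConfig (Site 3)) := {ω | ¬ ∃ x : Fin (M₁ + M₂ + 1) → Site 3, (∀ i, x i ∈ box 3 n) ∧
        (∀ i, ∃ y ∈ innerBoundary (zdGraph 3) (box 3 (2 * n)),
          ω ∈ openConnIn (↑(box 3 (2 * n)) : Set (Site 3)) (x i) y) ∧
        ∀ i j, i ≠ j → ω ∉ openConnIn (↑(box 3 (2 * n)) : Set (Site 3)) (x i) (x j)} with hGdef
    -- pigeonhole: `A ⊆ G ∪ D`
    have hsub : A ⊆ G ∪ D := by
      intro ω hωA
      by_cases hωG : ω ∈ G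
      · exact Or.inl hωG
      right
      simp only [hGdef, Set.mem_setOf_eq, not_not] at hωG
      obtain ⟨x, hxbox, hxbd, hxbad⟩ := hωG
      rcases pigeonhole_tuple (M₁ := M₁) (M₂ := M₂) x (fun z => ω ∈ percolatesAt z)
          (fun z w => ω ∉ openConnIn (↑(box 3 (2 * n)) : Set (Site 3)) z w) hxbad with
        ⟨y, hy, hyQ, hybad⟩ | ⟨y, hy, hyQ, hybad⟩
      · exfalso
        refine hωA ⟨y, fun a => ?_, hyQ, hybad⟩
        obtain ⟨i, hi⟩ := hy a
        rw [hi]; exact hxbox i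
      · refine ⟨y, fun a => ?_, hyQ, fun a => ?_, hybad⟩
        · obtain ⟨i, hi⟩ := hy a
          rw [hi]; exact hxbox i
        · obtain ⟨i, hi⟩ := hy a
          rw [hi]; exact hxbd i
    have hle : μ.real A ≤ μ.real G + μ.real D :=
      (measureReal_mono hsub).trans (measureReal_union_le G D)
    change c / 2 ≤ μ.real G
    linarith

/-- **The crux, by name, modulo the three registered stubs.** -/
theorem NonProliferation_proof : NonProliferation :=
  NonProliferation_of stub_infiniteClusterFewClasses stub_jumpFiniteDebrisTight stub_contSureResidue

/-! ### Certificates recorded with the line -/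

/-- **S3 is dominated by the target of route `PercBudgetLadder` (stmt-CriticalPhenomena-5247), vacuously:**
i.o. blocking with probability `≥ c` at one ratio `l ≥ 2` contradicts sure crossing at ratio `l`. -/
theorem contSureResidue_of_critAnnulusBlockedIO
    (h : Summit.CriticalPhenomena.PercolationContinuityZ3.Theses.PercBudgetLadder.CritAnnulusBlockedIO) :
    Stubs.stub_contSureResidue := by
  rw [stub_contSureResidue_iff]
  intro _ hsure
  obtain ⟨l, c, hl, hc, hio⟩ := h
  exfalso
  set μ : Measure (BondConfig (Site 3)) := bondPercolation (zdGraph 3) (criticalProbI 3) with hμ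
  have hev := (tendsto_order.1 (hsure l hl)).1 (1 - c) (by linarith)
  obtain ⟨N, hN⟩ := eventually_atTop.1 hev
  obtain ⟨n, hNn, hblock⟩ := hio N
  have hlt := hN n hNn
  have hcompl : μ.real {ω | ¬ ∃ x ∈ box 3 n, ∃ y ∈ innerBoundary (zdGraph 3) (box 3 (l * n)),
        ω ∈ openConnIn (↑(box 3 (l * n)) : Set (Site 3)) x y} =
      1 - μ.real {ω | ∃ x ∈ box 3 n, ∃ y ∈ innerBoundary (zdGraph 3) (box 3 (l * n)),
        ω ∈ openConnIn (↑(box 3 (l * n)) : Set (Site 3)) x y} := by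
    rw [show {ω : BondConfig (Site 3) | ¬ ∃ x ∈ box 3 n, ∃ y ∈ innerBoundary (zdGraph 3) (box 3 (l * n)),
          ω ∈ openConnIn (↑(box 3 (l * n)) : Set (Site 3)) x y} =
        {ω : BondConfig (Site 3) | ∃ x ∈ box 3 n, ∃ y ∈ innerBoundary (zdGraph 3) (box 3 (l * n)),
          ω ∈ openConnIn (↑(box 3 (l * n)) : Set (Site 3)) x y}ᶜ from rfl]
    exact probReal_compl_eq_one_sub (RatioDichotomy.measurableSet_crossing 3 n (l * n))
  have hblock' : c ≤ 1 - μ.real {ω | ∃ x ∈ box 3 n, ∃ y ∈ innerBoundary (zdGraph 3) (box 3 (l * n)),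
        ω ∈ openConnIn (↑(box 3 (l * n)) : Set (Site 3)) x y} := by
    rw [← hcompl]; exact hblock
  linarith

/-- **S1 is a consequence of the summit** (in a continuous world there are a.s. no percolating points, so
S1's event is almost sure; `M = 0`, `c = 1`). -/
theorem infiniteClusterFewClasses_of_continuity (h : _root_.PercolationContinuityZ3) :
    Stubs.stub_infiniteClusterFewClasses := by
  rw [stub_infiniteClusterFewClasses_iff]
  have h0 : theta (zdGraph 3) (0 : Site 3) (criticalProbI 3) = 0 :=
    Literature.Probability.Percolation.percolationContinuityZ3_iff.1 h
  set μ : Measure (BondConfig (Site 3)) := bondPercolation (zdGraph 3) (criticalProbI 3) with hμ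
  -- every site percolates with probability `θ = 0` (translation invariance)
  have hx0 : ∀ x : Site 3, μ.real (percolatesAt x) = 0 := by
    intro x
    have := theta_zdGraph_eq_theta_zero (d := 3) (criticalProbI 3) x
    unfold theta at this h0
    rw [hμ, this, h0]
  refine ⟨0, 1, one_pos, Frequently.of_forall fun n => ?_⟩
  -- the bad event is contained in `⋃_{x ∈ B(n)} {x percolates}`, a null set
  have hbad : μ.real {ω | ∃ x : Fin (0 + 1) → Site 3, (∀ i, x i ∈ box 3 n) ∧ (∀ i, ω ∈ percolatesAt (x i)) ∧
      ∀ i j, i ≠ j → ω ∉ openConnIn (↑(box 3 (2 * n)) : Set (Site 3)) (x i) (x j)} = 0 := by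
    refine le_antisymm ?_ measureReal_nonneg
    calc μ.real _ ≤ μ.real (⋃ x ∈ box 3 n, percolatesAt x) := by
          refine measureReal_mono ?_ (measure_ne_top _ _)
          rintro ω ⟨x, hx, hperc, -⟩
          exact Set.mem_biUnion (hx 0) (hperc 0)
      _ ≤ ∑ x ∈ box 3 n, μ.real (percolatesAt x) := measureReal_biUnion_finset_le _ _
      _ = 0 := Finset.sum_eq_zero fun x _ => hx0 x
  have hmeas : MeasurableSet {ω : BondConfig (Site 3) | ∃ x : Fin (0 + 1) → Site 3, (∀ i, x i ∈ box 3 n) ∧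
      (∀ i, ω ∈ percolatesAt (x i)) ∧
      ∀ i j, i ≠ j → ω ∉ openConnIn (↑(box 3 (2 * n)) : Set (Site 3)) (x i) (x j)} := by
    refine measurableSet_setOf.2 (Measurable.exists fun x => ?_)
    refine measurable_const.and ((Measurable.forall fun i => ?_).and
      (Measurable.forall fun i => Measurable.forall fun j => measurable_const.imp ?_))
    · exact (measurableSet_percolatesAt_holds (x i)).mem
    · exact (measurableSet_openConnIn_of_countable _ (x i) (x j)).mem.not
  have hcompl := probReal_compl_eq_one_sub (μ := μ) hmeas
  rw [hbad, sub_zero] at hcompl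
  rw [show {ω : BondConfig (Site 3) | ¬ ∃ x : Fin (0 + 1) → Site 3, (∀ i, x i ∈ box 3 n) ∧
      (∀ i, ω ∈ percolatesAt (x i)) ∧
      ∀ i j, i ≠ j → ω ∉ openConnIn (↑(box 3 (2 * n)) : Set (Site 3)) (x i) (x j)} =
    {ω : BondConfig (Site 3) | ∃ x : Fin (0 + 1) → Site 3, (∀ i, x i ∈ box 3 n) ∧
      (∀ i, ω ∈ percolatesAt (x i)) ∧
      ∀ i j, i ≠ j → ω ∉ openConnIn (↑(box 3 (2 * n)) : Set (Site 3)) (x i) (x j)}ᶜ from rfl, hcompl]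

/-- **The crux implies S1** (percolating sites of `B(n)` are spanning representatives of `B(2n)` for lattice
configurations, which are almost sure). -/
theorem infiniteClusterFewClasses_of_nonProliferation (h : NonProliferation) :
    Stubs.stub_infiniteClusterFewClasses := by
  rw [stub_infiniteClusterFewClasses_iff]
  obtain ⟨M, c, hc, hfreq⟩ := h
  set μ : Measure (BondConfig (Site 3)) := bondPercolation (zdGraph 3) (criticalProbI 3) with hμ
  refine ⟨M, c, hc, hfreq.mono fun n hn => hn.trans ?_⟩
  -- up to the null set of non-lattice configurations, {N_n ≤ M} ⊆ S1-event
  have hae : ∀ᵐ ω ∂μ, ω ⊆ (zdGraph 3).edgeSet := ProbabilityTheory.setBernoulli_ae_subset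
  refine ENNReal.toReal_mono (measure_ne_top _ _) (measure_mono_ae (hae.mono fun ω hω hωN => ?_))
  rintro ⟨x, hxbox, hperc, hbad⟩
  exact hωN ⟨x, hxbox, fun i => exists_openConnIn_innerBoundary_of_percolatesAt
    (box_mono 3 (show n ≤ 2 * n by omega) (hxbox i)) hω (hperc i), hbad⟩

open scoped Classical in
/-- **The route decides the summit from S1 alone** (re-glued `closes` for the tenure planner):
`FreeBoxSparse → S1 → θ(p_c(ℤ³)) = 0`, over the landed supports `densityWhp_proof`, the counting lemma
`sq_card_le_mul_card_filter_of_not_exists` (with `good :=` "percolates", so no spanning hypothesis is needed)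
and the abstract assembly `nonProlifAssembly_abstract` / `nonProlifAssembly_markov`. -/
theorem continuity_of_freeBoxSparse_of_fewClasses (hSparse : FreeBoxSparse)
    (hS1 : Stubs.stub_infiniteClusterFewClasses) :
    _root_.PercolationContinuityZ3 := by
  rw [stub_infiniteClusterFewClasses_iff] at hS1
  unfold FreeBoxSparse at hSparse
  refine Literature.Probability.Percolation.percolationContinuityZ3_iff.2 ?_
  by_contra hne
  have hθ : 0 < theta (zdGraph 3) (0 : Site 3) (criticalProbI 3) := lt_of_le_of_ne theta_nonneg (Ne.symm hne)
  obtain ⟨M, c, hc, hfreq⟩ := hS1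
  have hD := densityWhp_proof (criticalProbI 3)
  have hK : ∀ n : ℕ, (0 : ℝ) < ((box 3 n).card : ℝ) := fun n =>
    Nat.cast_pos.2 (Finset.card_pos.2 (box_nonempty 3 n))
  have hA : (bondPercolation (zdGraph 3) (criticalProbI 3)).real (Set.univ : Set (BondConfig (Site 3)))ᶜ = 0 := by
    simp
  have hVm : ∀ n : ℕ, Measurable fun ω : BondConfig (Site 3) =>
      ((((box 3 n).filter fun x => ω ∈ percolatesAt x).card : ℕ) : ℝ) := fun n =>
    nonProlifAssembly_measurable_card_filter (box 3 n) (fun x => percolatesAt x)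
      (fun x => measurableSet_percolatesAt_holds x)
  have hSI : ∀ n : ℕ, Integrable (fun ω : BondConfig (Site 3) =>
      ((((box 3 n ×ˢ box 3 n).filter fun q => ω ∈ openConnIn ↑(box 3 (2 * n)) q.1 q.2).card : ℕ) : ℝ))
        (bondPercolation (zdGraph 3) (criticalProbI 3)) ∧
      ∫ ω, ((((box 3 n ×ˢ box 3 n).filter fun q => ω ∈ openConnIn ↑(box 3 (2 * n)) q.1 q.2).card : ℕ) : ℝ)
        ∂(bondPercolation (zdGraph 3) (criticalProbI 3)) =
      ∑ q ∈ box 3 n ×ˢ box 3 n, (bondPercolation (zdGraph 3) (criticalProbI 3)).real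
        (openConnIn ↑(box 3 (2 * n)) q.1 q.2) := fun n =>
    nonProlifAssembly_integral_card_filter (bondPercolation (zdGraph 3) (criticalProbI 3)) (box 3 n ×ˢ box 3 n)
      (fun q : Site 3 × Site 3 => openConnIn (↑(box 3 (2 * n)) : Set (Site 3)) q.1 q.2)
      (fun q => measurableSet_openConnIn_of_countable _ _ _)
  have h2n : Tendsto (fun n : ℕ => 2 * n) atTop atTop :=
    tendsto_atTop_mono (fun n : ℕ => show n ≤ 2 * n by omega) tendsto_id
  have hu : Tendsto (fun n : ℕ => 64 * ((∑ x ∈ box 3 (2 * n), ∑ y ∈ box 3 (2 * n),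
      (bondPercolation (zdGraph 3) (criticalProbI 3)).real (openConnIn ↑(box 3 (2 * n)) x y)) /
        ((box 3 (2 * n)).card : ℝ) ^ 2)) atTop (𝓝 0) := by
    have h := (hSparse.comp h2n).const_mul 64
    rw [mul_zero] at h
    exact h
  have hES : ∀ n : ℕ,
      ∫ ω, ((((box 3 n ×ˢ box 3 n).filter fun q => ω ∈ openConnIn ↑(box 3 (2 * n)) q.1 q.2).card : ℕ) : ℝ)
        ∂(bondPercolation (zdGraph 3) (criticalProbI 3)) ≤
      64 * ((∑ x ∈ box 3 (2 * n), ∑ y ∈ box 3 (2 * n),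
        (bondPercolation (zdGraph 3) (criticalProbI 3)).real (openConnIn ↑(box 3 (2 * n)) x y)) /
          ((box 3 (2 * n)).card : ℝ) ^ 2) * ((box 3 n).card : ℝ) ^ 2 := by
    intro n
    rw [(hSI n).2, Finset.sum_product]
    have hT0 : 0 ≤ ∑ x ∈ box 3 (2 * n), ∑ y ∈ box 3 (2 * n),
        (bondPercolation (zdGraph 3) (criticalProbI 3)).real (openConnIn ↑(box 3 (2 * n)) x y) :=
      Finset.sum_nonneg fun x _ => Finset.sum_nonneg fun y _ => measureReal_nonneg
    have hc2 : ((box 3 (2 * n)).card : ℝ) ^ 2 ≠ 0 := (pow_pos (hK (2 * n)) 2).ne'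
    calc ∑ x ∈ box 3 n, ∑ y ∈ box 3 n,
          (bondPercolation (zdGraph 3) (criticalProbI 3)).real (openConnIn ↑(box 3 (2 * n)) x y)
        ≤ ∑ x ∈ box 3 (2 * n), ∑ y ∈ box 3 (2 * n),
          (bondPercolation (zdGraph 3) (criticalProbI 3)).real (openConnIn ↑(box 3 (2 * n)) x y) :=
          polynomialAssembly_sum_sum_mono (box_mono 3 (by omega)) fun x y => measureReal_nonneg
      _ = (∑ x ∈ box 3 (2 * n), ∑ y ∈ box 3 (2 * n),
          (bondPercolation (zdGraph 3) (criticalProbI 3)).real (openConnIn ↑(box 3 (2 * n)) x y)) /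
            ((box 3 (2 * n)).card : ℝ) ^ 2 * ((box 3 (2 * n)).card : ℝ) ^ 2 :=
          (div_mul_cancel₀ _ hc2).symm
      _ ≤ (∑ x ∈ box 3 (2 * n), ∑ y ∈ box 3 (2 * n),
          (bondPercolation (zdGraph 3) (criticalProbI 3)).real (openConnIn ↑(box 3 (2 * n)) x y)) /
            ((box 3 (2 * n)).card : ℝ) ^ 2 * (64 * ((box 3 n).card : ℝ) ^ 2) :=
          mul_le_mul_of_nonneg_left (nonProlifAssembly_card_box_two_mul_sq_le n) (div_nonneg hT0 (sq_nonneg _))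
      _ = _ := by ring
  have hS : ∀ δ : ℝ, 0 < δ → Tendsto (fun n : ℕ => (bondPercolation (zdGraph 3) (criticalProbI 3)).real
      {ω : BondConfig (Site 3) | δ * ((box 3 n).card : ℝ) ^ 2 ≤
        ((((box 3 n ×ˢ box 3 n).filter fun q => ω ∈ openConnIn ↑(box 3 (2 * n)) q.1 q.2).card : ℕ) : ℝ)})
      atTop (𝓝 0) := fun δ hδ =>
    nonProlifAssembly_markov (bondPercolation (zdGraph 3) (criticalProbI 3)) hK (fun n ω => Nat.cast_nonneg _)
      (fun n => (hSI n).1) hES hu hδ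
  refine nonProlifAssembly_abstract (bondPercolation (zdGraph 3) (criticalProbI 3)) (M := M) hθ hc hK hA hfreq
    (V := fun n ω => ((((box 3 n).filter fun x => ω ∈ percolatesAt x).card : ℕ) : ℝ)) ?_
    (fun n => measurableSet_le measurable_const (hVm n)) hD hS
  intro n ω _ hωG
  have hsub : box 3 n ⊆ box 3 (2 * n) := box_mono 3 (by omega)
  have hcount := sq_card_le_mul_card_filter_of_not_exists (box 3 n)
    ((box 3 n).filter fun x => ω ∈ percolatesAt x)
    (fun x y => ω ∈ openConnIn (↑(box 3 (2 * n)) : Set (Site 3)) x y)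
    (fun x => ω ∈ percolatesAt x) M (Finset.filter_subset _ _) ?_ ?_ ?_ ?_ hωG
  · exact_mod_cast hcount
  · intro x hx
    have hxS : x ∈ (↑(box 3 (2 * n)) : Set (Site 3)) :=
      Finset.mem_coe.2 (hsub (Finset.mem_filter.1 hx).1)
    exact ⟨hxS, hxS, SimpleGraph.Reachable.refl _⟩
  · rintro x y ⟨hx, hy, h⟩
    exact ⟨hy, hx, h.symm⟩
  · rintro x y z ⟨hx, hy, h⟩ ⟨_, hz, h'⟩
    exact ⟨hx, hz, h.trans h'⟩
  · intro x hx
    exact (Finset.mem_filter.1 hx).2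

end Summit.CriticalPhenomena.PercolationContinuityZ3.Cruxes.NonProliferation.JumpFragmentation

end
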